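import Summits.QuantumFields.YangMills.Theorems.LuscherReductionRunningReductionExplicitNoIntruder
import Summits.QuantumFields.YangMills.Theorems.FemtoTransferGapLevelsPos
import HarnessLib

/-!
# Crux RED, line «KTR» rev 3: the owner's costume test d4 in the kernel — the `∃`-constraint long-time no-intruder bound at level `k`
# is EQUIVALENT to KT's stub 3 at level `k`; what `ExplicitNoIntruder k` adds is exactly the NAMING of the constraints

Support module (fleet service by seat ym-infvol-p2; owner ym-beyond-p1 g17 memo `OWNER-MEMO-3a-g17.md` §1 d4 «costume test»: «any satisfiable
`∃`-over-states cut is satisfied by EIGENVECTOR TRANSPORT as soon as the law holds and the spectral layer exists») for crux `RunningReduction`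
(route `LuscherReduction`, item stmt-QuantumFields-19978), line «KTR» rev 3 part 4.

* §1 The ratio law RELATIVE TO AN INVARIANT CONSTRAINT SET: if a property `P` of physical test functions is preserved by `K_β` and every physical `χ`
  with `P χ` has Rayleigh quotient `≤ Λ` (`Λ ≥ 0`), then along the orbit of any physical `ψ` with `P ψ` the transfer moments obey `a_{j+1} ≤ Λ a_j`, hence
  `a_n ≤ Λⁿ a_0` (`transferMoment_succ_le_of_invariant`, `transferMoment_le_pow_mul_of_invariant`; even steps = the Rayleigh bound on the iterate, odd
  steps = log-convexity `transferMoment_succ_sq_le` + the even step) — the constraint-relative form of `transferMoment_le_pow_mul`.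
* §2 Orthogonality to EXACT eigenfunctions is `K_β`-invariant (`l2_transferApply_eigen_eq_zero`), and by Courant–Fischer domination
  (`exists_isPhys_eigenfamily_dominating_of_pos`, unconditional since `0 < λ_k` by `FemtoTransferGapLevelsPos`) the Rayleigh quotient off `φ₀ … φ_{k−1}` is
  `≤ λ_k`; so `ψ ⊥ φ_{<k} ⟹ ⟨ψ, K_βⁿ ψ⟩ ≤ λ_kⁿ ‖ψ‖²` for EVERY `n` (`transferMoment_le_levelValue_pow_of_perp_eigen`).
* §3 **`longTime_of_levelValue_le k`**: KT's stub 3 at level `k` (Lüscher's law from below with relative error `o(1)`) ⟹ the `∃`-CONSTRAINT long-time bound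
  (the body of `ExplicitNoIntruder k` with «`∃ t m u`, constraints `dressedLift β t m (u i)`» weakened to «`∃ φs` physical»): witnesses = the exact
  eigenfunctions, ANY time scale `M`; with `levelValue_le_of_longTime` (the glue, module `…ExplicitNoIntruder`) this is an EQUIVALENCE
  **`longTime_iff_levelValue_le k`**, and `explicitNoIntruder_imp_longTime` records `ExplicitNoIntruder k ⟹ ∃-version`.  READING (kernel-certified d4):
  the `∃`-over-states weakening of the fifth stub IS stub 3 in costume; the content of `ExplicitNoIntruder k` beyond stub 3 is exactly that the `k` killing
  constraints are dressed flowed Polyakov lifts `J_{t,m} u_i` of ONE-SITE functions — the completeness of the lifted one-site sector.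

HONEST FRAMING: femto rung R2b1 bookkeeping + fixed-lattice functional analysis; stub 3 and `ExplicitNoIntruder k` (`k ≥ 1`) remain OPEN (XL); nothing
here is infinite volume, a mass gap or Clay.
References: [cite: Luscher1983]; [cite: LuscherMunster1984]; M. Reed, B. Simon IV (1978) XIII.1 [cite: ReedSimonIV1978]; [cite: Luscher1977].
-/

set_option autoImplicit false

noncomputable section

open MeasureTheory Filter Topology Real
open Literature.MathematicalPhysics.QuantumFieldTheory
open Literature.MathematicalPhysics.QuantumLattice
open Literature.Analysis.OperatorTheory.YMMatrixModel

namespace Summit.QuantumFields.YangMills.Theorems.FemtoTransferGap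

variable {L : ℕ} [NeZero L]

/-! ### §1. The ratio law relative to a `K_β`-invariant constraint set -/

/-- **Constraint-relative ratio law**: `P` preserved by `K_β`, Rayleigh quotient `≤ Λ` on physical `P`-functions (`Λ ≥ 0`, `β ≥ 0`) ⟹
`a_{j+1}(ψ) ≤ Λ · a_j(ψ)` for every physical `ψ` with `P ψ`.  Even `j = 2s`: the Rayleigh bound for the iterate `K^sψ` (which satisfies `P`); odd `j = 2s+1`:
`a_{2s+2}² ≤ a_{2s+1} a_{2s+3} ≤ a_{2s+1} · Λ a_{2s+2}`. [cite: ReedSimonIV1978, Thm. XIII.1] -/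
theorem transferMoment_succ_le_of_invariant {β : ℝ} (hβ : 0 ≤ β) {Λ : ℝ} (hΛ : 0 ≤ Λ)
    (P : (GaugeConfig 3 L SU2 → ℝ) → Prop) (hPK : ∀ χ, IsPhys χ → P χ → P (transferApply β χ))
    (hdom : ∀ χ, IsPhys χ → P χ → qform su2Rep β χ χ ≤ Λ * l2 χ χ)
    {ψ : GaugeConfig 3 L SU2 → ℝ} (hψ : IsPhys ψ) (hP : P ψ) (j : ℕ) :
    transferMoment β ψ (j + 1) ≤ Λ * transferMoment β ψ j := by
  -- every iterate satisfies `P`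
  have hiter : ∀ s : ℕ, P ((transferApply (L := L) β)^[s] ψ) := by
    intro s
    induction s with
    | zero => simpa using hP
    | succ s ih => rw [Function.iterate_succ_apply']; exact hPK _ (isPhys_iterate_transferApply β hψ s) ih
  -- the even step
  have heven : ∀ s : ℕ, transferMoment β ψ (2 * s + 1) ≤ Λ * transferMoment β ψ (2 * s) := by
    intro s
    rw [transferMoment_two_mul_succ β hψ, transferMoment_two_mul β hψ]
    exact hdom _ (isPhys_iterate_transferApply β hψ s) (hiter s)
  obtain ⟨s, rfl | rfl⟩ := Nat.even_or_odd' j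
  · exact heven s
  · have hconv := transferMoment_succ_sq_le hβ hψ (2 * s + 1)
    have hev : transferMoment β ψ (2 * s + 1 + 2) ≤ Λ * transferMoment β ψ (2 * s + 1 + 1) := by
      have := heven (s + 1)
      convert this using 2 <;> ring_nf
    have ha1 : 0 ≤ transferMoment β ψ (2 * s + 1) := transferMoment_nonneg hβ hψ _
    have ha2 : 0 ≤ transferMoment β ψ (2 * s + 1 + 1) := transferMoment_nonneg hβ hψ _
    set x := transferMoment β ψ (2 * s + 1)
    set y := transferMoment β ψ (2 * s + 1 + 1)
    set z := transferMoment β ψ (2 * s + 1 + 2)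
    have hyy : y ^ 2 ≤ Λ * x * y := by
      calc y ^ 2 ≤ x * z := hconv
        _ ≤ x * (Λ * y) := mul_le_mul_of_nonneg_left hev ha1
        _ = Λ * x * y := by ring
    rcases ha2.eq_or_lt with hy0 | hypos
    · rw [← hy0]; exact mul_nonneg hΛ ha1
    · exact le_of_mul_le_mul_right (by rw [sq] at hyy; linarith [hyy]) hypos

/-- Hence `a_n(ψ) ≤ Λⁿ · a_0(ψ)` for physical `ψ` in a `K_β`-invariant constraint set with Rayleigh bound `Λ`. [cite: ReedSimonIV1978, Thm. XIII.1] -/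
theorem transferMoment_le_pow_mul_of_invariant {β : ℝ} (hβ : 0 ≤ β) {Λ : ℝ} (hΛ : 0 ≤ Λ)
    (P : (GaugeConfig 3 L SU2 → ℝ) → Prop) (hPK : ∀ χ, IsPhys χ → P χ → P (transferApply β χ))
    (hdom : ∀ χ, IsPhys χ → P χ → qform su2Rep β χ χ ≤ Λ * l2 χ χ)
    {ψ : GaugeConfig 3 L SU2 → ℝ} (hψ : IsPhys ψ) (hP : P ψ) (n : ℕ) :
    transferMoment β ψ n ≤ Λ ^ n * transferMoment β ψ 0 := by
  induction n with
  | zero => simp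
  | succ n ih =>
    calc transferMoment β ψ (n + 1) ≤ Λ * transferMoment β ψ n :=
          transferMoment_succ_le_of_invariant hβ hΛ P hPK hdom hψ hP n
      _ ≤ Λ * (Λ ^ n * transferMoment β ψ 0) := mul_le_mul_of_nonneg_left ih hΛ
      _ = Λ ^ (n + 1) * transferMoment β ψ 0 := by ring

/-! ### §2. Orthogonality to exact eigenfunctions is invariant; moments off `φ_{<k}` are bounded by `λ_kⁿ` -/

/-- `l2 ψ (c • φ) = c · l2 ψ φ`. [folklore] -/
theorem l2_smul_right (c : ℝ) (ψ η : GaugeConfig 3 L SU2 → ℝ) : l2 ψ (c • η) = c * l2 ψ η := by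
  rw [l2_comm, l2_smul_left, l2_comm]

/-- **Orthogonality to an exact eigenfunction is `K_β`-invariant**: `K_β η = λ η`, `⟨χ, η⟩ = 0` ⟹ `⟨K_β χ, η⟩ = ⟨χ, K_β η⟩ = λ⟨χ, η⟩ = 0`.
[cite: ReedSimonIV1978, Thm. XIII.1] -/
theorem l2_transferApply_eigen_eq_zero (β : ℝ) {χ η : GaugeConfig 3 L SU2 → ℝ} (hχ : IsPhys χ) (hη : IsPhys η) {lam : ℝ}
    (heig : transferApply β η = lam • η) (h0 : l2 χ η = 0) : l2 (transferApply β χ) η = 0 := by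
  rw [l2_transferApply_comm β hχ hη, heig, l2_smul_right, h0, mul_zero]

/-- **Moments off the first `k` exact eigenfunctions**: for `β > 0`, with `φ₀ … φ_k` the physical `l2`-orthonormal exact eigenfamily of
`exists_isPhys_eigenfamily_dominating_of_pos`, every physical `ψ ⊥ φ₀, …, φ_{k−1}` has `⟨ψ, K_βⁿ ψ⟩ ≤ λ_kⁿ ‖ψ‖²` for EVERY `n` (the orthogonal complement
is `K_β`-invariant and carries the Rayleigh bound `λ_k`). [cite: ReedSimonIV1978, Thm. XIII.1] [cite: Luscher1977, §3] -/
theorem transferMoment_le_levelValue_pow_of_perp_eigen {β : ℝ} (hβ : 0 < β) (k : ℕ) :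
    ∃ φs : Fin k → (GaugeConfig 3 L SU2 → ℝ), (∀ i, IsPhys (φs i)) ∧
      ∀ ψ : GaugeConfig 3 L SU2 → ℝ, IsPhys ψ → (∀ i, l2 ψ (φs i) = 0) →
        ∀ n : ℕ, l2 ψ ((transferApply β)^[n] ψ) ≤ levelValue su2Rep L β k ^ n * l2 ψ ψ := by
  obtain ⟨e, he, -, heig, hdom⟩ := exists_isPhys_eigenfamily_dominating_of_pos (L := L) hβ k
  refine ⟨fun i => e (Fin.castSucc i), fun i => he _, fun ψ hψ hperp n => ?_⟩
  -- the constraint set `P χ := χ ⊥ e_{<k}` is `K_β`-invariant with Rayleigh bound `λ_k`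
  set P : (GaugeConfig 3 L SU2 → ℝ) → Prop := fun χ => ∀ i : Fin k, l2 χ (e (Fin.castSucc i)) = 0 with hPdef
  have hPK : ∀ χ, IsPhys χ → P χ → P (transferApply β χ) := fun χ hχ hPχ i =>
    l2_transferApply_eigen_eq_zero β hχ (he _) (heig _) (hPχ i)
  have hdomP : ∀ χ, IsPhys χ → P χ → qform su2Rep β χ χ ≤ levelValue su2Rep L β k * l2 χ χ := by
    intro χ hχ hPχ
    have h := hdom (Fin.last k) χ hχ (fun i hi => ?_)
    · simpa using h
    · -- `i < last k` ⇒ `i = castSucc j`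
      have hik : (i : ℕ) < k := by simpa [Fin.lt_def] using hi
      have : i = Fin.castSucc ⟨i, hik⟩ := Fin.ext rfl
      rw [this]
      exact hPχ ⟨i, hik⟩
  have h := transferMoment_le_pow_mul_of_invariant hβ.le (levelValue_su2Rep_nonneg L hβ.le k) P hPK hdomP hψ hperp n
  rwa [transferMoment, transferMoment_zero] at h

/-! ### §3. Stub 3 at level `k` ⟹ the `∃`-constraint long-time bound; the equivalence -/

/-- **Stub 3 ⟹ the `∃`-constraint long-time bound (costume direction, PROVED).**  If Lüscher's law from below holds at level `k` with relative error
`o(1)` (KT's stub 3 at `k`: `∀ d < Δ_k`, eventually `λ_k ≤ e^{−dλ/L}λ_0`), then for every `ε > 0` and ANY time scale (here `M = 1`), eventually in the femto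
window there are `k` physical constraint states — the exact eigenfunctions `φ₀ … φ_{k−1}` — such that every physical `ψ ⊥` them obeys
`⟨ψ, K_βⁿ ψ⟩ ≤ e^{−(Δ_k − ε)·nλ/L} λ_0ⁿ ‖ψ‖²` for all `n` with `nλ/L ∈ [M, 2M]` (indeed for all `n`): `a_n ≤ λ_kⁿ a_0 ≤ (e^{−(Δ_k−ε)λ/L}λ_0)ⁿ a_0`.
This is the body of `ExplicitNoIntruder k` with its NAMED constraints `dressedLift β t m (u i)` replaced by `∃ φs`. [cite: ReedSimonIV1978, Thm. XIII.1] [cite: Luscher1983] -/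
theorem longTime_of_levelValue_le (k : ℕ)
    (h : ∀ d : ℝ, d < levelGap k → ∃ lam0 : ℝ, 0 < lam0 ∧ ∀ lam : ℝ, 0 < lam → lam ≤ lam0 →
      ∃ L0 : ℕ, ∀ (L : ℕ) [NeZero L], L0 ≤ L → ∀ β : ℝ, InFemtoWindow lam β L →
        levelValue su2Rep L β k ≤ Real.exp (-(d * luscherLambda β L) / L) * levelValue su2Rep L β 0) :
    ∀ ε : ℝ, 0 < ε → ∃ M : ℝ, 0 < M ∧ ∃ lam0 : ℝ, 0 < lam0 ∧ ∀ lam : ℝ, 0 < lam → lam ≤ lam0 →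
      ∃ L1 : ℕ, ∀ (L : ℕ) [NeZero L], L1 ≤ L → ∀ β : ℝ, InFemtoWindow lam β L →
        ∃ φs : Fin k → (GaugeConfig 3 L SU2 → ℝ), (∀ i, IsPhys (φs i)) ∧
          ∀ n : ℕ, M ≤ n * luscherLambda β L / L → n * luscherLambda β L / L ≤ 2 * M →
            ∀ ψ : GaugeConfig 3 L SU2 → ℝ, IsPhys ψ → (∀ i, l2 ψ (φs i) = 0) →
              l2 ψ ((transferApply β)^[n] ψ) ≤
                Real.exp (-((levelGap k - ε) * (n * luscherLambda β L / L))) * levelValue su2Rep L β 0 ^ n * l2 ψ ψ := by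
  intro ε hε
  obtain ⟨lam0, hlam0, H⟩ := h (levelGap k - ε) (by linarith)
  refine ⟨1, one_pos, lam0, hlam0, fun lam hlam hle => ?_⟩
  obtain ⟨L0, HL⟩ := H lam hlam hle
  refine ⟨L0, fun L _ hL0 β hw => ?_⟩
  have hβ : 0 < β := zero_lt_one.trans_le hw.1
  have hlaw := HL L hL0 β hw
  obtain ⟨φs, hφ, hmom⟩ := transferMoment_le_levelValue_pow_of_perp_eigen (L := L) hβ k
  refine ⟨φs, hφ, fun n _ _ ψ hψ hperp => ?_⟩
  have hk0 : 0 ≤ levelValue su2Rep L β k := levelValue_su2Rep_nonneg L hβ.le k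
  have hl2 : 0 ≤ l2 ψ ψ := l2_self_nonneg ψ
  have hL : (0 : ℝ) < L := Nat.cast_pos.mpr (Nat.pos_of_ne_zero (NeZero.ne L))
  -- `λ_kⁿ ≤ (e^{-dλ/L} λ_0)ⁿ = e^{-(Δ_k-ε)·nλ/L} λ_0ⁿ`
  have hexp : Real.exp (-((levelGap k - ε) * luscherLambda β L) / L) ^ n
      = Real.exp (-((levelGap k - ε) * (n * luscherLambda β L / L))) := by
    rw [← Real.exp_nat_mul]; congr 1; ring
  have hpow : levelValue su2Rep L β k ^ n
      ≤ Real.exp (-((levelGap k - ε) * (n * luscherLambda β L / L))) * levelValue su2Rep L β 0 ^ n := by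
    calc levelValue su2Rep L β k ^ n ≤ (Real.exp (-((levelGap k - ε) * luscherLambda β L) / L) * levelValue su2Rep L β 0) ^ n :=
          pow_le_pow_left₀ hk0 hlaw n
      _ = _ := by rw [mul_pow, hexp]
  calc l2 ψ ((transferApply β)^[n] ψ) ≤ levelValue su2Rep L β k ^ n * l2 ψ ψ := hmom ψ hψ hperp n
    _ ≤ Real.exp (-((levelGap k - ε) * (n * luscherLambda β L / L))) * levelValue su2Rep L β 0 ^ n * l2 ψ ψ :=
        mul_le_mul_of_nonneg_right hpow hl2

/-- **The equivalence (d4 in the kernel)**: the `∃`-constraint long-time no-intruder bound at level `k` ⟺ KT's stub 3 at level `k`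
(`levelValue_le_of_longTime` ∧ `longTime_of_levelValue_le`).  So the `∃`-over-states weakening of the fifth stub carries no content beyond stub 3; the
content of `ExplicitNoIntruder k` beyond stub 3 is exactly the NAMING of the constraints as dressed lifts of one-site functions.
[cite: ReedSimonIV1978, Thm. XIII.1] [cite: Luscher1983] -/
theorem longTime_iff_levelValue_le (k : ℕ) :
    (∀ ε : ℝ, 0 < ε → ∃ M : ℝ, 0 < M ∧ ∃ lam0 : ℝ, 0 < lam0 ∧ ∀ lam : ℝ, 0 < lam → lam ≤ lam0 →
      ∃ L1 : ℕ, ∀ (L : ℕ) [NeZero L], L1 ≤ L → ∀ β : ℝ, InFemtoWindow lam β L →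
        ∃ φs : Fin k → (GaugeConfig 3 L SU2 → ℝ), (∀ i, IsPhys (φs i)) ∧
          ∀ n : ℕ, M ≤ n * luscherLambda β L / L → n * luscherLambda β L / L ≤ 2 * M →
            ∀ ψ : GaugeConfig 3 L SU2 → ℝ, IsPhys ψ → (∀ i, l2 ψ (φs i) = 0) →
              l2 ψ ((transferApply β)^[n] ψ) ≤
                Real.exp (-((levelGap k - ε) * (n * luscherLambda β L / L))) * levelValue su2Rep L β 0 ^ n * l2 ψ ψ) ↔
    (∀ d : ℝ, d < levelGap k → ∃ lam0 : ℝ, 0 < lam0 ∧ ∀ lam : ℝ, 0 < lam → lam ≤ lam0 →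
      ∃ L0 : ℕ, ∀ (L : ℕ) [NeZero L], L0 ≤ L → ∀ β : ℝ, InFemtoWindow lam β L →
        levelValue su2Rep L β k ≤ Real.exp (-(d * luscherLambda β L) / L) * levelValue su2Rep L β 0) :=
  ⟨levelValue_le_of_longTime k, longTime_of_levelValue_le k⟩

/-- `ExplicitNoIntruder k` ⟹ its `∃`-constraint weakening (forget that the constraints are dressed lifts). [cite: Luscher1983] -/
theorem explicitNoIntruder_imp_longTime (k : ℕ) (h : ExplicitNoIntruder k) :
    ∀ ε : ℝ, 0 < ε → ∃ M : ℝ, 0 < M ∧ ∃ lam0 : ℝ, 0 < lam0 ∧ ∀ lam : ℝ, 0 < lam → lam ≤ lam0 →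
      ∃ L1 : ℕ, ∀ (L : ℕ) [NeZero L], L1 ≤ L → ∀ β : ℝ, InFemtoWindow lam β L →
        ∃ φs : Fin k → (GaugeConfig 3 L SU2 → ℝ), (∀ i, IsPhys (φs i)) ∧
          ∀ n : ℕ, M ≤ n * luscherLambda β L / L → n * luscherLambda β L / L ≤ 2 * M →
            ∀ ψ : GaugeConfig 3 L SU2 → ℝ, IsPhys ψ → (∀ i, l2 ψ (φs i) = 0) →
              l2 ψ ((transferApply β)^[n] ψ) ≤
                Real.exp (-((levelGap k - ε) * (n * luscherLambda β L / L))) * levelValue su2Rep L β 0 ^ n * l2 ψ ψ := by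
  intro ε hε
  obtain ⟨M, hM, lam0, hlam0, H⟩ := h ε hε
  refine ⟨M, hM, lam0, hlam0, fun lam hlam hle => ?_⟩
  obtain ⟨L1, HL⟩ := H lam hlam hle
  refine ⟨L1, fun L _ hL1 β hw => ?_⟩
  obtain ⟨t, m, u, hC, Hn⟩ := HL L hL1 β hw
  exact ⟨fun i => dressedLift β t m (u i), hC, Hn⟩

/-- **Round trip**: any proof of stub 3 at level `k` (in particular one obtained from `ExplicitNoIntruder k` through the glue) hands back the
`∃`-constraint long-time bound with EXACT EIGENFUNCTIONS as constraints — eigenvector transport, the owner's d4. [cite: Luscher1983] -/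
theorem longTime_of_explicitNoIntruder (k : ℕ) (h : ExplicitNoIntruder k) :
    ∀ ε : ℝ, 0 < ε → ∃ M : ℝ, 0 < M ∧ ∃ lam0 : ℝ, 0 < lam0 ∧ ∀ lam : ℝ, 0 < lam → lam ≤ lam0 →
      ∃ L1 : ℕ, ∀ (L : ℕ) [NeZero L], L1 ≤ L → ∀ β : ℝ, InFemtoWindow lam β L →
        ∃ φs : Fin k → (GaugeConfig 3 L SU2 → ℝ), (∀ i, IsPhys (φs i)) ∧
          ∀ n : ℕ, M ≤ n * luscherLambda β L / L → n * luscherLambda β L / L ≤ 2 * M →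
            ∀ ψ : GaugeConfig 3 L SU2 → ℝ, IsPhys ψ → (∀ i, l2 ψ (φs i) = 0) →
              l2 ψ ((transferApply β)^[n] ψ) ≤
                Real.exp (-((levelGap k - ε) * (n * luscherLambda β L / L))) * levelValue su2Rep L β 0 ^ n * l2 ψ ψ :=
  longTime_of_levelValue_le k (levelValue_le_of_explicitNoIntruder k h)

end Summit.QuantumFields.YangMills.Theorems.FemtoTransferGap

end
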